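import Summits.ResolutionOfSingularities.ResolutionOfSingularities.Theorems.PurelyInseparableDim4RidgeBudget
import Summits.ResolutionOfSingularities.ResolutionOfSingularities.Theorems.PurelyInseparableDim4NarrowPullback
import Summits.ResolutionOfSingularities.ResolutionOfSingularities.Theorems.PurelyInseparableDim4NarrowRidgeTransversal
import HarnessLib
import HarnessLib.Audit.Tags

/-!
# The NARROW LINE of the ridge trichotomy — typed stubs L1/L2/L3 for `RidgeBudget.NarrowDrop`

[OURS · res-dim4 cell, CARD I-3-10 (res-dim4-idea-3), memo `pub/res-dim4/res-dim4-idea-3/iso6/N1-PROOF.md`;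
independent hand proof at `p = 3`: res-dim4-crit-4 V-A4-09, `i378/N1-THEOREM.md`; critics crit-4 V-A4-11, crit-1
V-A-26, crit-2 V-B-34.]  STATUS: the three stubs are typed VERBATIM from idea-3's `HOME/res-dim4-idea-3/lean/NarrowLine.lean`
(sha16 12405623f2353fc4, «free for any prover to land», bus 19:28:47Z); at `q = p` two of them are now TREE THEOREMS and
this file records the one-line adapters: `pullbackContainment_self : PullbackContainment p p` (seat p-5 g2,
`NarrowPullback.aeval_mem_X_mul_singLocusIdeal`, p661331) and `ridgeTransversal_self : RidgeTransversal p p` (seat p-7 g2,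
`NarrowTransversal.ridgeTransversal`, p661385); `NarrowCurvilinear p p` (L1, seat p-1 g2) and the target
`RidgeBudget.NarrowDrop p p` (assembly, seat p-1 g2) follow.  For `q` not a power of `p` the stubs are not claimed (L2 is
false there).  Landed by seat res-dim4-p-7 g2 (desk WORD #43 (a) split).  Nothing here proves `NarrowDrop`, F4-I(p,p) or
resolution of singularities in dimension ≥ 4 / characteristic p.  Supports stmt-ResolutionOfSingularities-16155 (helper).

(N1) `NarrowDrop p p` should follow from: **L1** `NarrowCurvilinear` (a floor state with one-dimensional
ridge `K·w` is curvilinear along the ridge: `𝔪₀ ≤ (x_j) + J⁺ + 𝔪₀²` and `x_j^{μ⁺} ∈ J⁺ + 𝔪₀^M`, any `j` with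
`w_j ≠ 0`), **L2** `PullbackContainment` (Kollár, *Lectures on Resolution* (2007) (3.75)–Thm 3.76, adapted:
in characteristic `p` with marking `m = q = p` the zeroth-order term vanishes, so Hasse derivatives of order
`< q` pull back into `x_j · J⁺_q(F')`), **L3** `RidgeTransversal` (after blowing up the ridge point the new
ridge meets the exceptional hyperplane trivially), by: `x_j^μ ∈ Ĵ⁺(F)` ⇒ `x_j^μ ∈ x_j Ĵ⁺(F')` ⇒
`x_j^{μ-1} ∈ Ĵ⁺(F')` ⇒ `μ⁺(F') ≤ μ − 1`.  The implication itself is the prover's target (not stated here as a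
theorem).  [cite: Kollar2007, (3.75.1)–(3.75.3), Theorem 3.76] [cite: CossartJannsenSaito2020, Thm 3.10(4), Lemma 3.14]
-/

set_option linter.dupNamespace false

noncomputable section

namespace Summit.ResolutionOfSingularities.ResolutionOfSingularities.Theorems.PIDim4

namespace RidgeBudget

open MvPolynomial Finset
open Literature.AlgebraicGeometry.Resolution
open Literature.AlgebraicGeometry.Resolution.Hauser2010
open Literature.AlgebraicGeometry.Resolution.HauserPerlega2019
open Literature.Barriers.ResolutionOfSingularities
open PointBlowup (gradSpan additiveSubspace)

variable {K : Type} [Field K]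


/-- The chart substitution of the point blow-up at the point `b` of the chart `x_j` (`b_j = 0`):
`x_j ↦ x_j`, `x_i ↦ x_j (x_i + b_i)`. [cite: Hauser2010, §F (chart expressions of a point blowup)] -/
def chartSubst (j : Fin 4) (b : Fin 4 → K) (i : Fin 4) : MvPolynomial (Fin 4) K :=
  if i = j then X j else X j * (X i + C (b i))

/-- **L2 `PullbackContainment p q`**: for a `q`-fold state, every element of `J⁺_q(F)` pulls back under the
chart map into `x_j · J⁺_q(F'_b)`, `F'_b` the CLEANED successor (`CentreBlowup.step`).  (Hasse–Leibniz:
`C(q,i) ≡ 0 (mod p)` for `0 < i < q`; normal ordering of the old derivations `∂_i = x_j⁻¹ ∂'_i`,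
`∂_j = ∂'_j − x_j⁻¹ Σ (x_i + b_i) ∂'_i`; no zeroth-order term.)  OPEN. [OURS · candidate] -/
def PullbackContainment (p q : ℕ) : Prop :=
  ∀ (K : Type) [Field K] [CharP K p] [DecidableEq K] (s : State K) (j : Fin 4) (b : Fin 4 → K),
    b j = 0 → (q : ℕ∞) ≤ CentreBlowup.ordAlong Finset.univ s.F →
      ∀ h ∈ singLocusIdeal q s.F,
        MvPolynomial.aeval (chartSubst j b) h ∈
          Ideal.span {(X j : MvPolynomial (Fin 4) K)} *
            singLocusIdeal q (CentreBlowup.step q Finset.univ j b s).F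

/-- **L1 `NarrowCurvilinear p q`**: at a state of order `q` with a one-dimensional ridge `K·w`, for every
coordinate `x_j` with `w_j ≠ 0`: `𝔪₀ ≤ (x_j) + J⁺_q(F) + 𝔪₀²` (Euler descent on the `(q−1)`-th Hasse
derivatives of the initial form) and `x_j^{μ⁺(F)} ∈ J⁺_q(F) + 𝔪₀^M` for every `M` (the local algebra is
`K⟦x_j⟧/(x_j^μ)`).  OPEN. [OURS · candidate] -/
def NarrowCurvilinear (p q : ℕ) : Prop :=
  ∀ (K : Type) [Field K] [CharP K p] [DecidableEq K] (F : MvPolynomial (Fin 4) K) (N : ℕ)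
    (w : Fin 4 → K) (j : Fin 4),
    ordZero F = q → ebar F = 1 → IsCert q N F → w ∈ additiveSubspace (initialForm F) → w j ≠ 0 →
      originIdeal K ≤ Ideal.span {(X j : MvPolynomial (Fin 4) K)} ⊔ singLocusIdeal q F ⊔ originIdeal K ^ 2 ∧
        ∀ M : ℕ, (X j : MvPolynomial (Fin 4) K) ^ jetColength q N F ∈ singLocusIdeal q F ⊔ originIdeal K ^ M

/-- **L3 `RidgeTransversal p q`**: blowing up a state of order `q` with ridge `K·w` at its ridge point
(chart `j`, so `w_j ≠ 0`), the successor's ridge contains no non-zero vector tangent to the exceptional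
divisor `x_j = 0`.  OPEN (elementary on forms; census: transitions `ē : 1 → 2` never occur). [OURS · candidate] -/
def RidgeTransversal (p q : ℕ) : Prop :=
  ∀ (K : Type) [Field K] [CharP K p] [DecidableEq K] (s : State K) (j : Fin 4) (b : Fin 4 → K),
    ordZero s.F = q → ebar s.F = 1 → b j = 0 → CentreBlowup.IsEquimultiplePoint q Finset.univ j b s →
      ∀ w' ∈ additiveSubspace (initialForm (CentreBlowup.step q Finset.univ j b s).F), w' j = 0 → w' = 0

/-! ## Adapters: the stubs at `q = p` that are tree theorems -/

/-- **L2 holds at `q = p`** for every prime `p`: `PullbackContainment p p` — seat p-5 g2's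
`NarrowPullback.aeval_mem_X_mul_singLocusIdeal` (p661331) is its literal body.
[cite: Kollar2007, (3.75.1)–(3.75.3), Theorem 3.76] -/
theorem pullbackContainment_self (p : ℕ) [Fact p.Prime] : PullbackContainment p p :=
  fun _K _ _ _ s j b hbj hord _h hh => NarrowPullback.aeval_mem_X_mul_singLocusIdeal p s j b hbj hord hh

/-- **L3 holds at `q = p`** for every prime `p`: `RidgeTransversal p p` — seat p-7 g2's
`NarrowTransversal.ridgeTransversal` (p661385) is its literal body.
[cite: CossartJannsenSaito2020, Thm. 3.10 (4), Def. 3.13 (2) and Thm. 9.3] -/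
theorem ridgeTransversal_self (p : ℕ) [Fact p.Prime] : RidgeTransversal p p :=
  fun K _ _ _ => NarrowTransversal.ridgeTransversal p K

end RidgeBudget

end Summit.ResolutionOfSingularities.ResolutionOfSingularities.Theorems.PIDim4

end
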